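import Mathlib
import Summits.NavierStokesRegularity.NavierStokesRegularity.Theorems.FilamentSkeletonRssClause13TaylorRemainderKernel
import Summits.NavierStokesRegularity.NavierStokesRegularity.Theorems.FilamentSkeletonRssClause13SmoothingKernelFourier

/-!
# Clause 13-R, MODEL level: the Taylor-remainder (straight self-induction) operator is SYMMETRIC in the pairing —
# `∫ g·M_q[f] = ∫ f·M_q[g]` for `f ∈ C¹_c`, `g ∈ C¹` bounded with bounded derivative

Route `FilamentSkeletonRss`, crux `Clause13RNearStraightL` (stmt-NavierStokesRegularity-23612), line `rate_bordered_split`, STUB R `stub_rateRow13RFlat`.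
The rate-row mechanism (memo `CENSUS-23610-side-23612-g16.md` §3 (m5)) pairs the bordered defect with a WINDOWED affine weight
`ψ = χ·(τ−c)·b`; moving the model self operator `M_q[f](τ) = ∫ ((τ−σ)²+q)^{-3/2}(f τ − f σ − (τ−σ)f′σ) dσ = (2/q)f − K_q ∗ f`
(B2 `taylorRemainderOp_eq`, `K_q(s) = (2q − s²)(s²+q)^{-5/2}` EVEN) onto the weight is the step `⟨M_q Y, ψ⟩ = ⟨Y, M_q ψ⟩`, after which only the
Taylor remainder of `ψ` OFF its affine window is seen by `Y` (the «leak at the window edge»).  This file proves that symmetry: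

* `integrable_bdd_kernel_prod` — `(τ,σ) ↦ g(τ)K_q(τ−σ)f(σ)` is integrable on `ℝ²` for continuous bounded `g` and continuous compactly supported
  `f` (domination by `B·|f(σ)||K_q(τ−σ)|`, a convolution integrand);
* `integral_mul_taylorRemainder_comm` — **`∫ g τ · M_q[f](τ) dτ = ∫ f τ · M_q[g](τ) dτ`** (B2 on both sides, Fubini, evenness of `K_q`).

Companion of `…Clause13RAffineAnnihilator` (exact annihilation of UNWINDOWED affine weights).  Hand `leafhand-ns-filamentskeletonrs-3-g0` (LAND-ONLY);
`--supports stmt-NavierStokesRegularity-23612 --as helper`.  HONEST FRAMING: one-dimensional calculus for the MODEL operator of a HYPOTHETICAL filament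
skeleton on the NEGATIVE side of a MODEL blow-up route; nothing here bears on Navier–Stokes regularity or blow-up; STUB R is NOT proved here.
-/

noncomputable section

open MeasureTheory Filter Topology Set
open Summit.NavierStokesRegularity.NavierStokesRegularity.Theorems.MatchedKernel
  (taylorRemainderOp_eq continuous_smoothingKernel integrable_smoothingKernel_mul)

namespace Summit.NavierStokesRegularity.NavierStokesRegularity.Theorems.Clause13RTaylorRemainderSymmetry
set_option linter.dupNamespace false

/-- Integrability on `ℝ²` of `(τ, σ) ↦ g(τ)·K_q(τ−σ)·f(σ)` for continuous bounded `g` and continuous compactly supported `f`. [folklore] -/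
theorem integrable_bdd_kernel_prod {q B : ℝ} (hq : 0 < q) {f g : ℝ → ℝ} (hfc : Continuous f) (hfs : HasCompactSupport f)
    (hgc : Continuous g) (hgb : ∀ x, |g x| ≤ B) :
    Integrable (fun p : ℝ × ℝ => g p.1 * ((2 * q - (p.1 - p.2) ^ 2) * (((p.1 - p.2) ^ 2 + q) ^ (5 / 2 : ℝ))⁻¹) * f p.2)
      (volume.prod volume) := by
  set K : ℝ → ℝ := fun s => (2 * q - s ^ 2) * ((s ^ 2 + q) ^ (5 / 2 : ℝ))⁻¹ with hK
  have hKc : Continuous K := continuous_smoothingKernel hq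
  have hKi : Integrable K := by
    have h := integrable_smoothingKernel_mul hq continuous_const (φ := fun _ => (1:ℝ)) (fun _ => by simp)
    simpa using h
  have hB : 0 ≤ B := (abs_nonneg _).trans (hgb 0)
  have hfi : Integrable (fun σ : ℝ => B * |f σ|) :=
    Continuous.integrable_of_hasCompactSupport (continuous_const.mul hfc.abs) (hfs.norm).mul_left
  have hc := hfi.convolution_integrand (ContinuousLinearMap.mul ℝ ℝ) hKi.norm (μ := volume) (ν := volume)
  refine hc.mono' ?_ (Eventually.of_forall fun p => ?_)
  · exact (((hgc.comp continuous_fst).mul (hKc.comp (continuous_fst.sub continuous_snd))).mul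
      (hfc.comp continuous_snd)).aestronglyMeasurable
  · obtain ⟨τ, σ⟩ := p
    simp only [ContinuousLinearMap.mul_apply', Real.norm_eq_abs]
    show |g τ * K (τ - σ) * f σ| ≤ B * |f σ| * |K (τ - σ)|
    rw [abs_mul, abs_mul]
    have h1 := hgb τ
    have h2 := abs_nonneg (K (τ - σ))
    have h3 := abs_nonneg (f σ)
    calc |g τ| * |K (τ - σ)| * |f σ| ≤ B * |K (τ - σ)| * |f σ| := by gcongr
      _ = B * |f σ| * |K (τ - σ)| := by ring

/-- **SYMMETRY OF THE MODEL SELF OPERATOR IN THE PAIRING.**  For `q > 0`, `f ∈ C¹(ℝ)` with compact support and `g ∈ C¹(ℝ)` with `|g|, |g′| ≤ B`: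
`∫ g τ·(∫ ((τ−σ)²+q)^{-3/2}(f τ − f σ − (τ−σ) f′σ) dσ) dτ = ∫ f τ·(∫ ((τ−σ)²+q)^{-3/2}(g τ − g σ − (τ−σ) g′σ) dσ) dτ`. [folklore] -/
theorem integral_mul_taylorRemainder_comm {q B : ℝ} (hq : 0 < q) {f g : ℝ → ℝ} (hf : ContDiff ℝ 1 f) (hfs : HasCompactSupport f)
    (hg : ContDiff ℝ 1 g) (hgb : ∀ x, |g x| ≤ B) (hg'b : ∀ x, |deriv g x| ≤ B) :
    ∫ τ : ℝ, g τ * (∫ σ : ℝ, (((τ - σ) ^ 2 + q) ^ (3 / 2 : ℝ))⁻¹ * (f τ - f σ - (τ - σ) * deriv f σ))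
      = ∫ τ : ℝ, f τ * (∫ σ : ℝ, (((τ - σ) ^ 2 + q) ^ (3 / 2 : ℝ))⁻¹ * (g τ - g σ - (τ - σ) * deriv g σ)) := by
  set K : ℝ → ℝ := fun s => (2 * q - s ^ 2) * ((s ^ 2 + q) ^ (5 / 2 : ℝ))⁻¹ with hK
  have hfc : Continuous f := hf.continuous
  have hgc : Continuous g := hg.continuous
  -- bounds for `f`, `f′`
  obtain ⟨B₁, hB₁⟩ := hfc.bounded_above_of_compact_support hfs
  have hf'c : Continuous (deriv f) := hf.continuous_deriv le_rfl
  obtain ⟨B₂, hB₂⟩ := hf'c.bounded_above_of_compact_support hfs.deriv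
  have hfb : ∀ x, |f x| ≤ max B₁ B₂ := fun x => by rw [← Real.norm_eq_abs]; exact (hB₁ x).trans (le_max_left _ _)
  have hf'b : ∀ x, |deriv f x| ≤ max B₁ B₂ := fun x => by rw [← Real.norm_eq_abs]; exact (hB₂ x).trans (le_max_right _ _)
  -- B2 on both sides
  have hB2f : ∀ τ : ℝ, ∫ σ : ℝ, (((τ - σ) ^ 2 + q) ^ (3 / 2 : ℝ))⁻¹ * (f τ - f σ - (τ - σ) * deriv f σ)
      = 2 / q * f τ - ∫ σ : ℝ, K (τ - σ) * f σ := fun τ => taylorRemainderOp_eq hq hf hfb hf'b τ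
  have hB2g : ∀ τ : ℝ, ∫ σ : ℝ, (((τ - σ) ^ 2 + q) ^ (3 / 2 : ℝ))⁻¹ * (g τ - g σ - (τ - σ) * deriv g σ)
      = 2 / q * g τ - ∫ σ : ℝ, K (τ - σ) * g σ := fun τ => taylorRemainderOp_eq hq hg hgb hg'b τ
  simp_rw [hB2f, hB2g]
  -- Fubini integrands
  have hF₁ := integrable_bdd_kernel_prod hq hfc hfs hgc hgb            -- (τ,σ) ↦ g τ K(τ−σ) f σ
  have hF₁l : Integrable (fun τ : ℝ => ∫ σ : ℝ, g τ * K (τ - σ) * f σ) := hF₁.integral_prod_left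
  have hF₂ : Integrable (fun p : ℝ × ℝ => f p.1 * K (p.1 - p.2) * g p.2) (volume.prod volume) := by
    -- `f τ K(τ−σ) g σ = (g σ K(σ−τ) f τ) ∘ swap` by evenness of `K`
    have h := hF₁.swap
    refine h.congr (Eventually.of_forall fun p => ?_)
    obtain ⟨τ, σ⟩ := p
    simp only [Function.comp, Prod.swap_prod_mk, hK]
    rw [show (σ - τ) ^ 2 = (τ - σ) ^ 2 by ring]
    ring
  have hF₂l : Integrable (fun τ : ℝ => ∫ σ : ℝ, f τ * K (τ - σ) * g σ) := hF₂.integral_prod_left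
  have hgf : Integrable (fun τ : ℝ => g τ * (2 / q * f τ)) :=
    Continuous.integrable_of_hasCompactSupport (hgc.mul (continuous_const.mul hfc)) (hfs.mul_left (f := fun _ => 2 / q)).mul_left
  have hfg : Integrable (fun τ : ℝ => f τ * (2 / q * g τ)) :=
    Continuous.integrable_of_hasCompactSupport (hfc.mul (continuous_const.mul hgc)) (hfs.mul_right (f' := fun τ => 2 / q * g τ))
  -- split both sides
  have hsplit₁ : (fun τ : ℝ => g τ * (2 / q * f τ - ∫ σ : ℝ, K (τ - σ) * f σ))
      = fun τ => g τ * (2 / q * f τ) - ∫ σ : ℝ, g τ * K (τ - σ) * f σ := by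
    funext τ; rw [mul_sub, ← integral_const_mul]; congr 1
    exact integral_congr_ae (Eventually.of_forall fun σ => by simp only [hK]; ring)
  have hsplit₂ : (fun τ : ℝ => f τ * (2 / q * g τ - ∫ σ : ℝ, K (τ - σ) * g σ))
      = fun τ => f τ * (2 / q * g τ) - ∫ σ : ℝ, f τ * K (τ - σ) * g σ := by
    funext τ; rw [mul_sub, ← integral_const_mul]; congr 1
    exact integral_congr_ae (Eventually.of_forall fun σ => by simp only [hK]; ring)
  rw [hsplit₁, hsplit₂, integral_sub hgf hF₁l, integral_sub hfg hF₂l]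
  congr 1
  · exact integral_congr_ae (Eventually.of_forall fun τ => by simp only []; ring)
  · -- swap the first double integral and use evenness
    rw [integral_integral_swap hF₁]
    refine integral_congr_ae (Eventually.of_forall fun a => ?_)
    refine integral_congr_ae (Eventually.of_forall fun b => ?_)
    simp only [hK]
    rw [show (b - a) ^ 2 = (a - b) ^ 2 by ring]
    ring

end Summit.NavierStokesRegularity.NavierStokesRegularity.Theorems.Clause13RTaylorRemainderSymmetry

end
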